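import Summits.QuantumFields.BalabanUV.T4Continuum.Support.HodgeCorrectionLaws
import Summits.QuantumFields.BalabanUV.T4Continuum.Support.GaugeTermScalarData
import Summits.QuantumFields.BalabanUV.T4Continuum.Support.ScalarGaugeProjectionUnit
import Literature.MathematicalPhysics.QuantumFieldTheory.Balaban1983to89.B5DeltaA169

/-!
# T⁴ programme, spine node NE2 (U1a) — THE DICTIONARY B0 AS KERNEL EQUATIONS: [B9] (3.3)/(3.4)/(3.8)/(3.10)/(3.23)/(3.26) for colour
# transporters, written in the tree's operators, and the EXACT identity «principal part of Δ_a(U) = row B2 + row B2.w − row B4» at one level,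
# with the `U = 1` base `= Δ_a ⊗ 1 − a·Q*Q ⊗ 1` CERTIFIED (so the located residuals of B0 are exactly: (3.10)'s `Δ′`, the averaging term, the instance)

Cell `pub-balaban-gaps` (YM blitz, track G2, seat ne2 = spine estimate NE2; census `run/shared/lean/pub/pub-balaban-gaps/ne/NE2.md`, repair R5 of
`ne/NE2-R5-PLAN.md`, OPERATOR HALF; the INSTANCE HALF `Rg := Ad ∘ U` is `Spine/NE2/AdjointFieldInstance`).  Trigger `t4/T4-NE2-TRIGGER.json` c5: «B0 (dictionary
`Δ_a(U)` = [B9] (3.23) entry-wise) is a reading …; no tier-B file asserts it; every tier-B theorem is about the typed operator».  The typed tier-B operator of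
ROOT B is `Δ_a ⊗ 1 + covPertC R + avgPert R + gaugeSlot R …` (`Spine/NE2BalabanRoot`/`NE2BalabanGauge`); its Hodge-form variant adds `hodgeCorr`
(`Support/HodgeModelSlot`).  [Balaban1985BackgroundPropagators] prints, for a background `U` with transporters «R(U(b))», «R(U)X = UXU⁻¹» (p.390):
(3.3) p.391 `(D_μλ)(x) = η⁻¹(R(U(x,x+ηe_μ))λ(x+ηe_μ) − λ(x))`; (3.4) p.391 `(DA)(p_{μν}(x)) = (D_μA_ν)(x) − (D_νA_μ)(x)`; (3.8) p.392 `D*` = the adjoint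
of `D`; (3.10) p.392 «⟨A, ΔA⟩ = ⟨A, D*DA⟩ + ⟨A, Δ′A⟩ … Δ′ will be a bounded, small operator»; (3.23) p.394 «Δ^η_U = D^{η*}_U D^η_U»; (3.25) p.394
«R = I − G′Q′*(Q′G′²Q′*)⁻¹Q′G′», (3.26) p.395 «Δ_a(U) = Δ(U) + D R(U) D* + Q*(U) a Q(U) … It coincides with Δ_a in (2.19) if U = 1».
THIS FILE types these sentences ON THE TREE's CARRIERS at ONE level (`Tor Nf`, lattice factor `c = η⁻¹`, colour transporters `Rb : Fin d → Tor Nf → M_o(ℂ)`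
DATA — e.g. `AdjointFieldInstance.stowerOf P (adRep hF) U k`) and proves what is an identity:
 * §1 THE PRINTED OPERATORS ARE THE TREE's: (3.3) = `ScalarCovariantLaplacian.scovD` = `WeitzenbockBridge.D0` (`D0_eq_scovD`, `rfl`) with the printed
   entry formula **`scovD_mulVec_apply`**; the covariant gradient `GaugeTermDecomposition.covGrad` has the components `scovD_μ` (**`covGrad_apply`**);
   (3.23) `D*D = covGradᴴ·covGrad = covLapS` (tree, `covGrad_conjTranspose_mul_covGrad`); the divergence form `D D* = lift(divᴴdiv)`
   (**`lift_divGram_eq_covGrad_mul`** — [B9] (3.8)'s `D*` on 1-forms is `LatticeWeitzenbock.divOp`); (3.4)/(3.10): `D*D` on 1-forms is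
   `hessB9 := lift(½·curlᴴcurl)` (ordered pairs, whence ½; `LatticeWeitzenbock.curlOp`);
 * §2 **`principalB9 c Rb X := hessB9 + sand Rb (1 − X)`** — (3.26) WITHOUT `Δ′` and WITHOUT the averaging term, `R(U) = 1 − X` (`X = P(U)`, DATA or the tree's
   `GaugeTermLayer`/`projP`), and THE KERNEL EQUATION **`principalB9_eq`**: `principalB9 c Rb X = covLapC c (slotLift Rb) + lift (commOp (D0 c Rb)) − sand Rb X`
   (row B2's componentwise covariant Laplacian + row B2.w's Weitzenböck/holonomy blocks − row B4's sandwich) — `WeitzenbockBridge.hodge_sub_covLapC` + §1;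
   the two-background difference **`principalB9_sub`** = `(covLapC − lapC) + lift commOp − (sand Rb X − sand 1 X₀)` (= `covPertC + hodgeCorr + gaugeSlot` at one level);
 * §3 THE `U = 1` BASE CERTIFIED: **`principalB9_one`** (`Rb ≡ 1`, `X = X₀ ⊗ 1`: `= (Lap − ∂X₀∂ᴴ) ⊗ 1`, the commutator blocks vanish) and
   **`principalB9_one_Pone`**: with the tree's `U = 1` resolvent projection `Pone` of (3.25) (`ScalarGaugeProjectionUnit.Pone_eq`: `= PcT + Pker`),
   `principalB9 n 1 (Pone ⊗ 1) + a•(Q*Q) ⊗ 1 = calDa ⊗ 1` — [B9]'s «coincides with Δ_a … if U = 1» for the typed objects (`B5DeltaA169.calDa_eq_DeltaA`).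
CONSEQUENCE (the B0 ledger, census §4 G1): `Δ_a(U)` of (3.26) on the single region `Ω₀ = T`, `a_j ≡ a`, EQUALS the tree's Hodge-form tier-B operator
`Δ_a ⊗ 1 + covPertC + hodgeCorr + gaugeSlot + [averaging summand]` UP TO exactly three named residuals: (r1) (3.10)'s `Δ′` (typed as a form in
`Literature/…/B9Eq310DeltaPrime`, no operator law in the tree); (r2) the averaging term `Q*(U)aQ(U)` = composition of linearised [Balaban1985Averaging] (15)
averagings vs the model's covariant line-sum `avgPert` (untyped, DIVERGENCE F6); (r3) the instance `Rb = Ad U_k(V)` in the (3.35)-gauge (node NE3's carrier;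
`AdjointFieldInstance`).  The instance of record (without `hodgeCorr`) differs additionally by `lift commOp` (row B2.w, laws `HodgeCorrectionLaws`).

HONEST FRAMING (T4-DAG p. 1).  [folklore] finite-dimensional algebra about the tree's typed objects; `Rb`, `X`, `X₀` DATA; the [B9] equations are cited as
the SHAPES being typed, nothing printed is a hypothesis or a conclusion; NO analytic statement; it does NOT assert that the Hessian of the Wilson action is
`hessB9 + Δ′` (that expansion, (3.1)–(3.7), is not typed), NOR anything about minimisers; single region (no Dirichlet data (3.27), no layers (3.16)/(3.24));
NE2 (U1a) NOT PROVED; spine PROVED 0/9 unchanged; NOT continuum YM, NOT infinite volume / mass gap / Clay.  HONEST DEPENDENCY: continuum YM on T⁴ ⇐ BetaPertH ∧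
nine spine estimates (0/9 proved); BetaPertH ⇐ (D1) ∧ (D4) ∧ CAP+tail; G-an2-4 gates asym, D1 and NE2/3/4.  No `sorry`; the only `def`s are the two named
operators `hessB9`, `principalB9` (objects, NOT facts).
-/

noncomputable section

open scoped BigOperators ComplexConjugate Matrix Matrix.Norms.L2Operator Kronecker

namespace Summit.QuantumFields.BalabanUV.T4Continuum.NE2.DictionaryB0

open Literature.MathematicalPhysics.QuantumFieldTheory.Balaban1983to89.B5Prop11Plancherel (Tor fine unitVec shiftM fdiff)
open Literature.MathematicalPhysics.QuantumFieldTheory.Balaban1983to89.B5Prop11Inverse (calDa)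
open Literature.MathematicalPhysics.QuantumFieldTheory.Balaban1983to89.B5Action121 (shiftS GradOp LapV)
open Literature.MathematicalPhysics.QuantumFieldTheory.Balaban1983to89.B5Block118 (QvOp)
open Literature.MathematicalPhysics.QuantumFieldTheory.Balaban1983to89.B5Prop11Lower (Lap)
open Literature.MathematicalPhysics.QuantumFieldTheory.Balaban1983to89.B5Value126 (PcT)
open Literature.MathematicalPhysics.QuantumFieldTheory.Balaban1983to89.B5DeltaA169 (QvAdj DeltaA calDa_eq_DeltaA)
open Summit.QuantumFields.BalabanUV.T4Continuum
open Summit.QuantumFields.BalabanUV.T4Continuum.KroneckerLift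
open Summit.QuantumFields.BalabanUV.T4Continuum.BlockMultiplication
open Summit.QuantumFields.BalabanUV.T4Continuum.ColourCovariantLaplacian (covLapC lapC lapC_eq)
open Summit.QuantumFields.BalabanUV.T4Continuum.GaugeTermDecomposition (injM covGrad sand covGrad_one liftR)
open Summit.QuantumFields.BalabanUV.T4Continuum.ScalarCovariantLaplacian (scovD covLapS covGrad_eq_sum_scovD covGrad_conjTranspose_mul_covGrad)
open Summit.QuantumFields.BalabanUV.T4Continuum.LatticeWeitzenbock (oneOp curlOp divOp roughOp commOp weitzenbock div_gram_apply commOp_affine)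
open Summit.QuantumFields.BalabanUV.T4Continuum.WeitzenbockBridge (lift lift_apply lift_add lift_sub lift_smul lift_mul D0 slotLift covLapC_eq_lift_rough
  hodge_sub_covLapC)
open Summit.QuantumFields.BalabanUV.T4Continuum.ScalarGaugeProjectionUnit (Pone GradOp_Pone_GradOpH_eq)
open Summit.QuantumFields.BalabanUV.T4Continuum.HodgeCorrectionLaws (holField holField_one lift_commOp_D0_eq_sum hodgeCorr)
open Summit.QuantumFields.BalabanUV.T4Continuum.ColourCovariantLaplacian (covPertC)
open Summit.QuantumFields.BalabanUV.T4Continuum.KingPairingPlantedLaw (calDalev)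
open Summit.QuantumFields.BalabanUV.T4Continuum.BalabanAveragedTowerUnit (idx one_le_lev')
open Literature.MathematicalPhysics.QuantumFieldTheory.Balaban1983to89.B5G183RateUnitTower (lev lev_neZero)
open Summit.QuantumFields.BalabanUV.T4Continuum.GaugeTermSandwichBound (projP Nop)
open Summit.QuantumFields.BalabanUV.T4Continuum.GaugeTermLayer (Gop gaugeP)
open Summit.QuantumFields.BalabanUV.T4Continuum.GaugeTermPerturbationLaw (gaugeTerm oneR)
open Summit.QuantumFields.BalabanUV.T4Continuum.GaugeTermScalarData (QuT Q1 Gop_one_eq Bs_eq_Qiso_kron gram_one_eq)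
open Summit.QuantumFields.BalabanUV.T4Continuum.ScalarGaugeProjectionUnit (Pone_eq_iso)

variable {d : ℕ} (Nf : Fin d → ℕ) [hNf : ∀ μ, NeZero (Nf μ)] {o : Type*} [Fintype o] [DecidableEq o]

/-! ## §1 The printed operators are the tree's operators -/

/-- (3.3): the two typings of the covariant difference on colour 0-forms coincide — `WeitzenbockBridge.D0 = ScalarCovariantLaplacian.scovD` (`rfl`).
[cite: Balaban1985BackgroundPropagators, (3.3) p.391 (shape)] [folklore] -/
theorem D0_eq_scovD (c : ℂ) (Rb : Fin d → Tor Nf → Matrix o o ℂ) : D0 Nf c Rb = scovD Nf c Rb := rfl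

/-- **(3.3) LETTER FOR LETTER**: `(D_μλ)(x) = c·(R_μ(x)·λ(x + e_μ) − λ(x))` — the entries of the tree's `scovD_μ` acting on a colour 0-form `λ`
(`c = η⁻¹`, `R_μ(x) = R(U(x, x + ηe_μ))`). [cite: Balaban1985BackgroundPropagators, (3.3) p.391 «(D^η_{U,μ}λ)(x) = η⁻¹(R(U(x,x+ηe_μ))λ(x+ηe_μ) − λ(x))»] [folklore] -/
theorem scovD_mulVec_apply (c : ℂ) (Rb : Fin d → Tor Nf → Matrix o o ℂ) (μ : Fin d) (lam : Tor Nf × o → ℂ) (x : Tor Nf) (a : o) :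
    (scovD Nf c Rb μ *ᵥ lam) (x, a) = c * ((Rb μ x *ᵥ fun b => lam (x + unitVec Nf μ, b)) a - lam (x, a)) := by
  rw [scovD, Matrix.smul_mulVec, Pi.smul_apply, smul_eq_mul, Matrix.sub_mulVec, Pi.sub_apply, Matrix.one_mulVec]
  congr 2
  rw [Matrix.mulVec, dotProduct, Fintype.sum_prod_type, Finset.sum_eq_single (x + unitVec Nf μ)]
  · rw [Matrix.mulVec, dotProduct]
    refine Finset.sum_congr rfl fun b _ => ?_
    rw [siteMul_mul_kron_apply]
    simp [shiftS]
  · intro y _ hy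
    refine Finset.sum_eq_zero fun b _ => ?_
    rw [siteMul_mul_kron_apply]
    simp [shiftS, hy]
  · intro h; exact absurd (Finset.mem_univ _) h

/-- entries of `(injM_μ ⊗ 1)·X`: the `μ`-th component row block is `X`, the others vanish. [folklore] -/
theorem injM_kron_mul_apply {τ : Type*} (μ : Fin d) (X : Matrix (Tor Nf × o) τ ℂ) (x : Tor Nf) (κ : Fin d) (a : o) (q : τ) :
    (injM Nf μ ⊗ₖ (1 : Matrix o o ℂ) * X) ((x, κ), a) q = if κ = μ then X (x, a) q else 0 := by
  rw [Matrix.mul_apply, Fintype.sum_prod_type, Finset.sum_eq_single x]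
  · rw [Finset.sum_eq_single a]
    · simp only [Matrix.kroneckerMap_apply, injM, Matrix.one_apply_eq, mul_one, Prod.mk.injEq, true_and]
      split_ifs <;> simp
    · intro b _ hb
      simp [Matrix.kroneckerMap_apply, Ne.symm hb]
    · intro h; exact absurd (Finset.mem_univ _) h
  · intro y _ hy
    refine Finset.sum_eq_zero fun b _ => ?_
    simp [Matrix.kroneckerMap_apply, injM, Ne.symm hy]
  · intro h; exact absurd (Finset.mem_univ _) h

/-- **the covariant gradient's components are the covariant differences**: `(D_R)_{((x,κ),a),q} = (scovD_κ)_{(x,a),q}`, i.e. `(D_Rλ)(x, κ) = (D_κλ)(x)`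
([B9] (3.3): «(D^η_{U_0,μ}λ)(x) = (D^η_{U_0}λ)(x, x + ηe_μ)»). [cite: Balaban1985BackgroundPropagators, (3.3) p.391 (shape)] [folklore] -/
theorem covGrad_apply (c : ℂ) (Rb : Fin d → Tor Nf → Matrix o o ℂ) (x : Tor Nf) (κ : Fin d) (a : o) (q : Tor Nf × o) :
    covGrad Nf c Rb ((x, κ), a) q = scovD Nf c Rb κ (x, a) q := by
  rw [covGrad_eq_sum_scovD, Matrix.sum_apply, Finset.sum_eq_single κ]
  · rw [injM_kron_mul_apply, if_pos rfl]
  · intro μ _ hμ; rw [injM_kron_mul_apply, if_neg (Ne.symm hμ)]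
  · intro h; exact absurd (Finset.mem_univ _) h

/-- (3.23): «Δ^η_U = D^{η*}_U D^η_U» — the tree's `covLapS = Σ_μ scovD_μᴴ scovD_μ` IS `D_Rᴴ D_R` (`ScalarCovariantLaplacian.covGrad_conjTranspose_mul_covGrad`
BY NAME, restated in B0's vocabulary). [cite: Balaban1985BackgroundPropagators, (3.23) p.394 (shape)] [folklore] -/
theorem covLapS_eq_DstarD (c : ℂ) (Rb : Fin d → Tor Nf → Matrix o o ℂ) : (covGrad Nf c Rb)ᴴ * covGrad Nf c Rb = covLapS Nf c Rb :=
  covGrad_conjTranspose_mul_covGrad Nf c Rb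

/-- **`D_R D_Rᴴ = lift(divᴴdiv)`**: the divergence form of `LatticeWeitzenbock` ([B9] (3.8)'s `D*` on 1-forms, «(D*A)(x) = Σ_μ (D*_μA_μ)(x)»), lifted to row
B2's index convention, is the tree's gauge-term sandwich with `X = 1`. [cite: Balaban1985BackgroundPropagators, (3.8) p.392 (shape)] [folklore] -/
theorem lift_divGram_eq_covGrad_mul (c : ℂ) (Rb : Fin d → Tor Nf → Matrix o o ℂ) :
    lift Nf ((divOp (D0 Nf c Rb))ᴴ * divOp (D0 Nf c Rb)) = covGrad Nf c Rb * (covGrad Nf c Rb)ᴴ := by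
  ext ⟨⟨x, κ⟩, a⟩ ⟨⟨y, κ'⟩, b⟩
  rw [lift_apply, div_gram_apply, Matrix.mul_apply, Matrix.mul_apply]
  refine Finset.sum_congr rfl fun q _ => ?_
  rw [Matrix.conjTranspose_apply, Matrix.conjTranspose_apply, covGrad_apply, covGrad_apply, D0_eq_scovD]

/-- **(3.4)/(3.10): THE PRINCIPAL PART `D*D` OF BAŁABAN's `Δ(U)` ON 1-FORMS** — `⟨A, D*DA⟩ = Σ_p η^d |(DA)(p)|²` over plaquettes, `(DA)(p_{μν}(x)) =
(D_μA_ν)(x) − (D_νA_μ)(x)` — typed as `lift(½·curlᴴcurl)` (`LatticeWeitzenbock.curlOp` runs over ORDERED pairs `(μ, ν)`, each plaquette twice, whence `½`).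
The commutator term `Δ′` of (3.10) is NOT part of this object. [cite: Balaban1985BackgroundPropagators, (3.4) p.391, (3.10) p.392 (shapes)] [folklore] -/
def hessB9 (c : ℂ) (Rb : Fin d → Tor Nf → Matrix o o ℂ) : Matrix ((Tor Nf × Fin d) × o) ((Tor Nf × Fin d) × o) ℂ :=
  lift Nf ((2 : ℂ)⁻¹ • ((curlOp (D0 Nf c Rb))ᴴ * curlOp (D0 Nf c Rb)))

/-! ## §2 (3.26) without `Δ′` and without the averaging term, and the kernel equation -/

/-- **THE PRINCIPAL PART OF (3.26)**: `Δ(U) − Δ′ + D R(U) D*` with `R(U) = 1 − X` — `hessB9 + D_R (1 − X) D_Rᴴ`; `X` (print: `P(U) = G′Q′*(Q′G′²Q′*)⁻¹Q′G′` of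
(3.25), the tree's `GaugeTermLayer`/`projP` objects) is DATA here. [cite: Balaban1985BackgroundPropagators, (3.25) p.394, (3.26) p.395 (shapes)] [folklore] -/
def principalB9 (c : ℂ) (Rb : Fin d → Tor Nf → Matrix o o ℂ) (X : Matrix (Tor Nf × o) (Tor Nf × o) ℂ) :
    Matrix ((Tor Nf × Fin d) × o) ((Tor Nf × Fin d) × o) ℂ :=
  hessB9 Nf c Rb + sand Nf c Rb (1 - X)

/-- the sandwich is additive in the middle: `D_R (1 − X) D_Rᴴ = D_R D_Rᴴ − D_R X D_Rᴴ`. [folklore] -/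
theorem sand_one_sub (c : ℂ) (Rb : Fin d → Tor Nf → Matrix o o ℂ) (X : Matrix (Tor Nf × o) (Tor Nf × o) ℂ) :
    sand Nf c Rb (1 - X) = covGrad Nf c Rb * (covGrad Nf c Rb)ᴴ - sand Nf c Rb X := by
  rw [sand, sand, Matrix.mul_sub, Matrix.mul_one, Matrix.sub_mul]

/-- **THE KERNEL EQUATION OF B0 (principal part, one level)**: `Δ(U) − Δ′ + D(1 − X)D* = [Σ_μ ∇^R_μᴴ∇^R_μ componentwise] + [lifted commutator blocks
[∇_ν, ∇_μᴴ] = holonomy defects] − D_R X D_Rᴴ` — i.e. the principal part of [B9] (3.26) IS row B2's `covLapC` + row B2.w's correction − row B4's sandwich,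
EXACTLY (`WeitzenbockBridge.hodge_sub_covLapC` + `lift_divGram_eq_covGrad_mul`). [folklore] -/
theorem principalB9_eq (c : ℂ) (Rb : Fin d → Tor Nf → Matrix o o ℂ) (X : Matrix (Tor Nf × o) (Tor Nf × o) ℂ) :
    principalB9 Nf c Rb X = covLapC Nf c (slotLift Nf Rb) + lift Nf (commOp (D0 Nf c Rb)) - sand Nf c Rb X := by
  have h := hodge_sub_covLapC Nf c Rb
  rw [lift_add, lift_divGram_eq_covGrad_mul] at h
  rw [principalB9, sand_one_sub, hessB9, ← add_sub_assoc, ← h]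
  abel

/-- the commutator blocks vanish for trivial transporters: by `HodgeCorrectionLaws.lift_commOp_D0_eq_sum` the lifted commutator operator is
`Σ_{ν,μ} siteMul((c·c̄)•holField ν μ)·(mixed shifts)` with the HOLONOMY-DEFECT field `holField Rb ν μ x = R_ν(x)R_μ(x+e_ν−e_μ)ᴴ − R_μ(x−e_μ)ᴴR_ν(x−e_μ)`,
which is `0` at `Rb ≡ 1` (flat differences commute with their adjoints; [Balaban1984PropagatorsI] (1.21)/(1.69) «Δ = ∂*∂ + ∂∂*»). [folklore] -/
theorem lift_commOp_one (c : ℂ) : lift Nf (commOp (D0 Nf c fun (_ : Fin d) (_ : Tor Nf) => (1 : Matrix o o ℂ))) = 0 := by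
  rw [lift_commOp_D0_eq_sum]
  refine Finset.sum_eq_zero fun ν _ => Finset.sum_eq_zero fun μ _ => ?_
  have h0 : siteMul (fun i : Tor Nf × Fin d => (c * star c) • holField Nf (fun (_ : Fin d) (_ : Tor Nf) => (1 : Matrix o o ℂ)) ν μ i.1) = 0 := by
    ext p q
    simp [siteMul_apply, holField_one]
  rw [h0, Matrix.zero_mul]

/-- at trivial transporters row B2's operator is the free componentwise Laplacian `Δ ⊗ 1`. [folklore] -/
theorem covLapC_slotLift_one (c : ℂ) : covLapC Nf c (slotLift Nf fun (_ : Fin d) (_ : Tor Nf) => (1 : Matrix o o ℂ)) = lapC Nf c := by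
  rw [covLapC, lapC]
  refine Finset.sum_congr rfl fun ν _ => ?_
  have : ColourCovariantLaplacian.covDc Nf c (slotLift Nf fun (_ : Fin d) (_ : Tor Nf) => (1 : Matrix o o ℂ)) ν
      = fdiff Nf c ν ⊗ₖ (1 : Matrix o o ℂ) := by
    rw [ColourCovariantLaplacian.covDc, fdiff, Matrix.smul_kronecker, sub_kronecker, Matrix.one_kronecker_one]
    congr 2
    rw [show (slotLift Nf fun (_ : Fin d) (_ : Tor Nf) => (1 : Matrix o o ℂ)) ν = fun _ => 1 from rfl, siteMul_one, Matrix.one_mul]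
  rw [this]

/-- **THE TWO-BACKGROUND DIFFERENCE** (what tier B perturbs by): `principalB9 Rb X − principalB9 1 X₀ = (covLapC − lapC) + lift commOp − (sand Rb X − sand 1 X₀)` —
at one level, literally row B2's summand (`covPertC`) + row B2.w's (`hodgeCorr`) + row B4's (`gaugeSlot = −gaugeTerm`). [folklore] -/
theorem principalB9_sub (c : ℂ) (Rb : Fin d → Tor Nf → Matrix o o ℂ) (X X₀ : Matrix (Tor Nf × o) (Tor Nf × o) ℂ) :
    principalB9 Nf c Rb X - principalB9 Nf c (fun _ _ => 1) X₀
      = (covLapC Nf c (slotLift Nf Rb) - lapC Nf c) + lift Nf (commOp (D0 Nf c Rb))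
        - (sand Nf c Rb X - sand Nf c (fun _ _ => 1) X₀) := by
  rw [principalB9_eq, principalB9_eq, lift_commOp_one, ← covLapC_slotLift_one Nf c]
  abel

/-! ## §3 The `U = 1` base: «It coincides with Δ_a in (2.19) if U = 1» for the typed objects -/

/-- at trivial transporters and a colour-blind middle `X₀ ⊗ 1`: `principalB9 c 1 (X₀ ⊗ 1) = (Σ_ν∇_νᴴ∇_ν − ∂X₀∂ᴴ) ⊗ 1`. [folklore] -/
theorem principalB9_one (c : ℂ) (X₀ : Matrix (Tor Nf) (Tor Nf) ℂ) :
    principalB9 Nf c (fun _ _ => 1) (X₀ ⊗ₖ (1 : Matrix o o ℂ))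
      = (AbelianCovariantLaplacian.lap Nf c - GradOp Nf c * X₀ * (GradOp Nf c)ᴴ) ⊗ₖ (1 : Matrix o o ℂ) := by
  rw [principalB9_eq, lift_commOp_one, add_zero, covLapC_slotLift_one, lapC_eq, sand, covGrad_one, kron_conjTranspose, ← kron_mul, ← kron_mul,
    ← sub_kronecker]

section Unit

variable (n : ℕ) [NeZero n] (hn : 1 ≤ n) (M : Fin d → ℕ) [hM : ∀ μ, NeZero (M μ)] (a : ℝ) (ha : 0 < a) {a' : ℝ}

/-- **THE `U = 1` BASE OF B0, CERTIFIED**: with the tree's `U = 1` resolvent projection `Pone n M a′` of [B9] (3.25) (`= PcT + Pker`,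
`ScalarGaugeProjectionUnit.Pone_eq`; `∂·Pone·∂ᴴ = ∂·PcT·∂ᴴ`) in the middle, the principal part plus [Balaban1984PropagatorsI]'s averaging term `a·Q*Q`
IS the free operator of the route, colour-lifted: `principalB9 n 1 (Pone ⊗ 1) + (a•Q*Q) ⊗ 1 = calDa ⊗ 1` (`B5DeltaA169.calDa_eq_DeltaA`: `calDa = Δ − ∂PcT∂ᴴ + aQ*Q`).
[cite: Balaban1985BackgroundPropagators, (3.26) p.395 «It coincides with Δ_a in (2.19) if U = 1» (shape)] [folklore] -/
theorem principalB9_one_Pone (ha' : 0 < a') :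
    principalB9 (fine n M) (n : ℂ) (fun _ _ => 1) (Pone n M a' ⊗ₖ (1 : Matrix o o ℂ))
        + ((a : ℂ) • (QvAdj n M * QvOp n M)) ⊗ₖ (1 : Matrix o o ℂ)
      = calDa n hn M a ha ⊗ₖ (1 : Matrix o o ℂ) := by
  rw [principalB9_one, GradOp_Pone_GradOpH_eq n M ha', calDa_eq_DeltaA, DeltaA, ← Matrix.add_kronecker]
  rfl

end Unit

/-! ## §4 Along the tower: the Hodge-form tier-B operator of ROOT B IS print's principal part plus the FREE averaging term -/

section Tower

variable (L : ℕ) [NeZero L] (M : Fin d → ℕ) [hM : ∀ μ, NeZero (M μ)] (a : ℝ) (ha : 0 < a) {a' : ℝ}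

/-- **THE MODEL's `U = 1` MIDDLE IS `Pone ⊗ 1`**: row B4's free resolvent projection `projP (G′_1 ⊗ 1) (Q̃′ ⊗ 1)` (data `Q1 = Bs = Q̃′ ⊗ 1`, `Gop 1 Q1 = Gps ⊗ 1`)
is the colour lift of `ScalarGaugeProjectionUnit.Pone` (`= PcT + Pker`, [B9] (3.25) at `U = 1`). [folklore] -/
theorem projP_one_eq (ha' : 0 < a') (k : ℕ) :
    projP (fine (lev L k) M) (Gop L M (oneR L M (o := o)) (Q1 L M o) a' k) (Q1 L M o k)
      = Pone (lev L k) M a' ⊗ₖ (1 : Matrix o o ℂ) := by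
  rw [projP, Nop, gram_one_eq, kron_inv, Gop_one_eq, Q1, Bs_eq_Qiso_kron, kron_conjTranspose, ← kron_mul, ← kron_mul, ← kron_mul, ← kron_mul,
    ← Pone_eq_iso _ _ ha']

/-- row B4's summand at level `k` is the difference of the two sandwiches of §2 with the (3.25)-shaped middles (definitional). [folklore] -/
theorem gaugeTerm_eq_sand_sub (Rb : (k : ℕ) → Fin d → Tor (fine (lev L k) M) → Matrix o o ℂ)
    (T : (k : ℕ) → Tor (fine (lev L k) M) → Matrix o o ℂ) (ha' : 0 < a') (k : ℕ) :
    gaugeTerm L M Rb (QuT L M o T) (Q1 L M o) a' k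
      = sand (fine (lev L k) M) ((lev L k : ℕ) : ℂ) (Rb k) (projP (fine (lev L k) M) (Gop L M Rb (QuT L M o T) a' k) (QuT L M o T k))
        - sand (fine (lev L k) M) ((lev L k : ℕ) : ℂ) (fun _ _ => 1) (Pone (lev L k) M a' ⊗ₖ (1 : Matrix o o ℂ)) := by
  rw [gaugeTerm, gaugeP, gaugeP, projP_one_eq L M ha']

/-- **B0 ALONG THE TOWER — THE HODGE-FORM TIER-B OPERATOR IS PRINT's PRINCIPAL PART PLUS THE FREE AVERAGING TERM**: at every level `k`, for site transporters
`Rb` (e.g. `Ad ∘ U_k`) and site transports `T` (the data of `Q′(U)`, (3.19)):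
`Δ_a^{(k)} ⊗ 1 + covPertC k + hodgeCorr k − gaugeTerm k = principalB9 (L^k) (Rb k) (P_{U,k}) + (a·Q*_kQ_k) ⊗ 1`,
`P_{U,k} = projP (G′_k(U)) (Q′_k(U))` the tree's (3.25) middle.  Hence Bałaban's `Δ_a(U_k)` of (3.26) (single region, `a_j ≡ a`) equals ROOT B's Hodge-form
operator `Δ_a⊗1 + covPertC + hodgeCorr + gaugeSlot + avgPert` PLUS exactly `Δ′` (3.10) PLUS `[Q*(U)aQ(U) − a·Q*Q ⊗ 1 − avgPert]` (the two located residuals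
r1/r2 of the header); the instance of record (no `hodgeCorr`) differs by `hodgeCorr` in addition.  An IDENTITY between typed objects — no estimate, no
assertion about minimisers. [cite: Balaban1985BackgroundPropagators, (3.26) p.395 (shape)] [folklore] -/
theorem hodgeTierB_eq_principalB9 (Rb : (k : ℕ) → Fin d → Tor (fine (lev L k) M) → Matrix o o ℂ)
    (T : (k : ℕ) → Tor (fine (lev L k) M) → Matrix o o ℂ) (ha' : 0 < a') (k : ℕ) :
    calDalev L M a ha k ⊗ₖ (1 : Matrix o o ℂ) + covPertC L M (fun k => slotLift (fine (lev L k) M) (Rb k)) k + hodgeCorr L M Rb k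
        - gaugeTerm L M Rb (QuT L M o T) (Q1 L M o) a' k
      = principalB9 (fine (lev L k) M) ((lev L k : ℕ) : ℂ) (Rb k) (projP (fine (lev L k) M) (Gop L M Rb (QuT L M o T) a' k) (QuT L M o T k))
        + ((a : ℂ) • (QvAdj (lev L k) M * QvOp (lev L k) M)) ⊗ₖ (1 : Matrix o o ℂ) := by
  have hsub := sub_eq_iff_eq_add'.mp (principalB9_sub (fine (lev L k) M) ((lev L k : ℕ) : ℂ) (Rb k)
    (projP (fine (lev L k) M) (Gop L M Rb (QuT L M o T) a' k) (QuT L M o T k)) (Pone (lev L k) M a' ⊗ₖ (1 : Matrix o o ℂ)))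
  have hone := principalB9_one_Pone (o := o) (lev L k) (one_le_lev' L k) M a ha ha'
  rw [gaugeTerm_eq_sand_sub L M Rb T ha' k, hsub, calDalev, ← hone, covPertC, hodgeCorr]
  abel

end Tower

end Summit.QuantumFields.BalabanUV.T4Continuum.NE2.DictionaryB0

end
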